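import Literature.Combinatorics.Optimization.ShellLawPointwiseMixture
import Literature.Combinatorics.Optimization.ShellLawTypeBounds
import Literature.Probability.Distributions.HypergeometricStencilBounds
import HarnessLib

/-!
# Pointwise relative `x`-smoothness of a level-`1` shell law in the moderate-deviation window:
# `|(∇²)^k law_S(2s+1,·)(1)(x)| ≤ E_k · law_S(2s+1,1; y₀) + 4^k·e^{−(L−2k)²/(4N)}` and the window lower bound

Continuation of `ShellLawPointwiseMixture.lean` (the good/far mixture inequality at one point for a shell law,
the one-component lower bound, shell sizes) with the hypergeometric component inputs of
`Probability/Distributions/HypergeometricStencilBounds.lean` (good: the off-centre relative bound inside the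
window; far: the exponential stencil bound) and `HypergeometricRatioWindow.lean` (lit g35: window ratio bounds,
envelopes, the window lower bound). Fix a fixed-point-free involution `π` (a perfect matching), a `π`-stable
ground set `S` with `N` edges of `H`-type `(a, b, d)` (numbers of `HH`, mixed, `H̄H̄` edges) having TYPE MARGINS
`a, b, d ≥ βN + 1`, and `s` full edges with `βN ≤ s ≤ (4+β)N/8` (balanced cut size). The level-`1` shell law of the
block statistic `X = |U ∩ H|`, `law_S(2s+1,1;·)`, is the mixture over the half-vertex `v ∈ S` and the number `α`
of `HH` edges among the full ones of the shifted hypergeometric laws `δ_{[v∈H]+2α} ∗ Hyp(b_v, d_v; s−α)`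
(`ShellLawGeneratingPolynomial` §3).

* §1 bookkeeping at level `1` (`halfSets_one_data`: a half-set is a singleton `{v}`, `|{v} ∩ H| ≤ 1`, the stripped
  types `a−1 ≤ a_v ≤ a`, …, `a_v + b_v + d_v = N − 1`).
* §2 **`balanced_of_good`** (pure real arithmetic): if the reference point `y₀` is within `Λ` of
  `ν = s(2a+b)/N` and within `L` of the centre `[v∈H] + 2α + (s−α)b_v/(b_v+d_v)` of a component, then that
  component is BALANCED: `r = s−α ≥ β²N` and `(b_v+d_v) − r ≥ βN/8` (provided `L + Λ ≤ βs`, `L + Λ + 3 ≤ βN/8`)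
  — so good components need no separate typicality hypothesis.
* §3 **`good_component_bound`**: for such a good component the off-centre relative bound holds with the UNIFORM
  constant `E_k(N) = ((1+η̄)(η̄+Q̄))^{2k}·(1 + (4(√N+1)/3)·Q̄)`, `η̄ = 8(L+k+1)/(β₁⁴βN)`, `Q̄ = 2√192·√(2(2k+1)(1+η̄)/(β₁⁴βN))`,
  `β₁ = β²/8` (type margins ⇒ window margins `≥ β₁²βN`, variance `≥ β₁⁴βN`, `η ≤ η̄`).
* §4 **`far_component_bound`**: a component whose centre is farther than `L` from `y₀` obeys
  `|coeff_{y₀+u}((1−X)^{2k}·X^σ H)| ≤ 4^k·e^{−(L−2k)²/(4N)}·H(1)` (stencil at distance `≥ L−2k` from the component mean,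
  parametrised Chernoff tail with `u = (L−2k)/(2N)`).
* §5 **`abs_nab2_iter_shellLaw_one_le`** — THE POINTWISE RELATIVE BOUND: for `u ≤ 2k`,
  `|(∇²)^k law_S(2s+1,·)(1)(y₀+u)| ≤ E_k(N)·law_S(2s+1,1;y₀) + 4^k·e^{−(L−2k)²/(4N)}`.
(The companion WINDOW LOWER BOUND `law_S(2s+1,1;y₀) ≥ e^{−O((Λ+10)²/(β⁴N))}/poly(N)` — one component whose centre is
within `1` of `y₀`, its hypergeometric mixing weight and its atom each through `coeff_hyperGen_window_lower` — is the
subject of a separate file.)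

All PROVED, 0 sorry, no definitions, no named facts. Cell pnp-psdrank (prover g24; MEMO-26 §7 Steps 2–6 for ONE
ground set; the assembly over the `2k`-fold deleted ground sets of `ShellLawSmoothing.sum_abs_nab2_iter_fwdDiff_iter_le`
and the re-insertion comparability give the [BULK] input of Theorems brick 123). Constants are crude and asymptotic only.

## References
* [RollinRoss2010] A. Röllin, N. Ross, *Local limit theorems via Landau–Kolmogorov inequalities*,
  Bernoulli 21 (2015) 851–880, §3 Lemma 3.1, 3.3; §4.1 Thm 4.2.
* [Rothvoss2017] T. Rothvoß, *The matching polytope has exponential extension complexity*, J. ACM 64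
  (2017), §2 (PDF pp. 5–6): cuts, the partition of a cut by a perfect matching, the level classes.
* [Durrett2019] R. Durrett, *Probability: Theory and Examples*, 5th ed. (2019), §2.7 (tilting; Chernoff).
* [ChattamvelliShanmugam2020] R. Chattamvelli, R. Shanmugam, *Discrete Distributions in Engineering and the Applied
  Sciences* (2020), §7.4 Table 7.1 (hypergeometric recurrence, mean, variance).
-/

noncomputable section

open Finset Polynomial

namespace Literature.Combinatorics.Optimization

namespace ShellStep

open Literature.Combinatorics.StablePolynomials (hyperGen coeff_hyperGen coeff_hyperGen_nonneg eval_one_hyperGen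
  natDegree_hyperGen_le)
open Literature.Probability.Distributions.PoissonBinomial

variable {n : ℕ} {π : Fin n → Fin n}

/-! ### §1 Bookkeeping at level `1`: half-sets are singletons; stripped types -/

section Setup

variable (hπ : ∀ v, π (π v) = v) (hπ' : ∀ v, π v ≠ v)
include hπ hπ'

omit hπ in
/-- A half-set at level `1` is a singleton `{v}`, `v ∈ S`, and meets `H` in at most one vertex.
[cite: Rothvoss2017, §2 (PDF p. 6)] -/
theorem halfSets_one_data {S Y : Finset (Fin n)} {H : Finset (Fin n)} (hY : Y ∈ halfSets π S 1) :
    ∃ v ∈ S, Y = {v} ∧ (Y ∩ H).card ≤ 1 := by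
  rw [halfSets_one_eq_image hπ' S, mem_image] at hY
  obtain ⟨v, hv, rfl⟩ := hY
  exact ⟨v, hv, rfl, (card_le_card inter_subset_left).trans (card_singleton v).le⟩

/-- **Stripped types at level `1`.** For a `π`-stable `S` with `H`-type `(a,b,d)` (`a + b + d = |S|/2`) and
`Y ∈ halfSets_S(1)`, the stripped ground set `S ∖ (Y ∪ πY)` has type `(a_Y, b_Y, d_Y)` with
`a − 1 ≤ a_Y ≤ a`, `b − 1 ≤ b_Y ≤ b`, `d − 1 ≤ d_Y ≤ d` and `a_Y + b_Y + d_Y + 1 = a + b + d`.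
[cite: Rothvoss2017, §2 (PDF p. 5)] -/
theorem strip_one_types {S Y : Finset (Fin n)} (hS : ∀ v ∈ S, π v ∈ S) (H : Finset (Fin n))
    (hY : Y ∈ halfSets π S 1) :
    (reps π (vAA π S H)).card ≤ (reps π (vAA π (strip π S Y) H)).card + 1 ∧
    (reps π (vAA π (strip π S Y) H)).card ≤ (reps π (vAA π S H)).card ∧
    (reps π (vBH π S H ∪ vBN π S H)).card ≤ (reps π (vBH π (strip π S Y) H ∪ vBN π (strip π S Y) H)).card + 1 ∧
    (reps π (vBH π (strip π S Y) H ∪ vBN π (strip π S Y) H)).card ≤ (reps π (vBH π S H ∪ vBN π S H)).card ∧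
    (reps π (vDD π S H)).card ≤ (reps π (vDD π (strip π S Y) H)).card + 1 ∧
    (reps π (vDD π (strip π S Y) H)).card ≤ (reps π (vDD π S H)).card ∧
    (reps π (vAA π (strip π S Y) H)).card +
        ((reps π (vBH π (strip π S Y) H ∪ vBN π (strip π S Y) H)).card + (reps π (vDD π (strip π S Y) H)).card) + 1 =
      (reps π (vAA π S H)).card + ((reps π (vBH π S H ∪ vBN π S H)).card + (reps π (vDD π S H)).card) := by
  obtain ⟨h1, h2, h3⟩ := reps_card_strip_ge hπ hπ' hS H hY
  obtain ⟨h4, h5, h6⟩ := reps_card_le_of_subset (π := π) (S := S) (S' := strip π S Y) sdiff_subset H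
  have h7 := typeReps_strip_eq hπ hπ' hS H hY
  have h8 := two_mul_typeReps_eq_card hπ hπ' hS H
  have h9 := card_strip hπ hS hY
  refine ⟨h1, h4, h2, h5, h3, h6, ?_⟩
  omega

end Setup

/-! ### §2 Good components are balanced (pure real arithmetic) -/

/-- **Good components are balanced.** Real-variable bookkeeping: type `(a,b,d)` with `a + b + d = N`,
`b, d ≥ βN + 1`, stripped type `b − 1 ≤ b_Y ≤ b`, `d − 1 ≤ d_Y ≤ d`, balanced number of full edges
`βN ≤ s ≤ (4+β)N/8`, a reference point `y₀` within `Λ` of `ν = s(2a+b)/N` and within `L` of the component centre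
`h + 2(s−r) + r·b_Y/(b_Y+d_Y)` (`0 ≤ h ≤ 1`, `r ≥ 0` the number of non-`HH` full edges). If `L + Λ ≤ βs` and
`L + Λ + 3 ≤ βN/8` then `β²N ≤ r` and `r + βN/8 ≤ b_Y + d_Y`. (The centre is `h + 2s − rθ` with
`θ = (b_Y + 2d_Y)/(b_Y+d_Y) ∈ [1,2]`, and `2s − ν = s(b+2d)/N ∈ [3βs, (4+β)(b+2d)/8]`.)
[cite: Rothvoss2017, §2 (PDF p. 6)] [cite: RollinRoss2010, §4.1 Thm 4.2] -/
theorem balanced_of_good {N a b d s r bY dY h y₀ L Λ β : ℝ} (hβ : 0 < β) (hN0 : 0 < N)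
    (hN : a + b + d = N) (ha0 : 0 ≤ a) (hb : β * N + 1 ≤ b) (hd : β * N + 1 ≤ d)
    (hbY : b - 1 ≤ bY) (hdY : d - 1 ≤ dY)
    (hs : β * N ≤ s) (hs' : 8 * s ≤ (4 + β) * N) (hr0 : 0 ≤ r)
    (hh0 : 0 ≤ h) (hh1 : h ≤ 1)
    (hy : |y₀ - s * (2 * a + b) / N| ≤ Λ)
    (hgood : |y₀ - h - 2 * (s - r) - r * bY / (bY + dY)| ≤ L)
    (hL1 : L + Λ ≤ β * s) (hL2 : L + Λ + 3 ≤ β * N / 8) :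
    β ^ 2 * N ≤ r ∧ r + β * N / 8 ≤ bY + dY := by
  have hL0 : 0 ≤ L := (abs_nonneg _).trans hgood
  have hΛ0 : 0 ≤ Λ := (abs_nonneg _).trans hy
  have hβN1 : 0 ≤ β * N := by positivity
  have hs0 : 0 ≤ s := hβN1.trans hs
  have ha' : a = N - b - d := by linarith
  set m := bY + dY with hm
  have hbY0 : 0 < bY := by linarith
  have hdY0 : 0 ≤ dY := by linarith
  have hm0 : 0 < m := by linarith
  -- `q = r·bY/m ∈ [0, r]`
  set q := r * bY / m with hq
  have hq0 : 0 ≤ q := by positivity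
  have hqr : q ≤ r := by
    rw [hq, div_le_iff₀ hm0]
    exact mul_le_mul_of_nonneg_left (by linarith) hr0
  -- `2s − ν = s(b+2d)/N ∈ [3βs, (4+β)(b+2d)/8]`
  have hb2d0 : 0 ≤ b + 2 * d := by linarith
  have hb2d : b + 2 * d ≤ 2 * N := by linarith
  have hD : 2 * s - s * (2 * a + b) / N = s * (b + 2 * d) / N := by
    rw [ha']; field_simp; ring
  have hDlow : 3 * β * s ≤ s * (b + 2 * d) / N := by
    rw [le_div_iff₀ hN0]
    have h3 : 3 * β * N ≤ b + 2 * d := by linarith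
    have := mul_le_mul_of_nonneg_left h3 hs0
    linarith
  have hDup : s * (b + 2 * d) / N ≤ (4 + β) * (b + 2 * d) / 8 := by
    rw [div_le_div_iff₀ hN0 (by norm_num : (0 : ℝ) < 8)]
    have := mul_le_mul_of_nonneg_left hs' hb2d0
    linarith
  -- combine the two windows
  obtain ⟨hy1, hy2⟩ := abs_le.1 hy
  obtain ⟨hg1, hg2⟩ := abs_le.1 hgood
  have hlow : s * (b + 2 * d) / N - L - Λ ≤ 2 * r - q := by linarith
  have hup : 2 * r - q ≤ s * (b + 2 * d) / N + 1 + L + Λ := by linarith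
  constructor
  · -- `r ≥ βs ≥ β²N`
    have h1 : β * s ≤ r := by linarith
    calc β ^ 2 * N = β * (β * N) := by ring
      _ ≤ β * s := mul_le_mul_of_nonneg_left hs hβ.le
      _ ≤ r := h1
  · -- `m − r ≥ βN/4 − 3 − L − Λ ≥ βN/8`
    have h2 : r ≤ (4 + β) * (b + 2 * d) / 8 + 1 + L + Λ := by linarith
    have h3 : (4 + β) * (b + 2 * d) / 8 ≤ (b + 2 * d) / 2 + β * N / 4 := by
      have := mul_le_mul_of_nonneg_left hb2d hβ.le
      linarith
    have h4 : b + d - 2 ≤ m := by linarith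
    linarith

/-! ### §3 The good-component bound with a uniform constant -/

/-- Monotonicity of the good-component constant in its parameters: for `0 ≤ η ≤ η'`, `0 ≤ Q ≤ Q'`, `0 ≤ c ≤ c'`,
`((1+η)(η+Q))^m·(1 + cQ) ≤ ((1+η')(η'+Q'))^m·(1 + c'Q')`. [cite: RollinRoss2010, §3 (Lemma 3.1)] -/
theorem goodConst_mono (m : ℕ) {η η' Q Q' c c' : ℝ} (hη : 0 ≤ η) (hηη : η ≤ η') (hQ : 0 ≤ Q) (hQQ : Q ≤ Q')
    (hc : 0 ≤ c) (hcc : c ≤ c') :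
    ((1 + η) * (η + Q)) ^ m * (1 + c * Q) ≤ ((1 + η') * (η' + Q')) ^ m * (1 + c' * Q') := by
  have h0 : 0 ≤ (1 + η) * (η + Q) := mul_nonneg (by linarith) (by linarith)
  have h1 : (1 + η) * (η + Q) ≤ (1 + η') * (η' + Q') :=
    mul_le_mul (by linarith) (by linarith) (by linarith) (by linarith)
  have h2 : ((1 + η) * (η + Q)) ^ m ≤ ((1 + η') * (η' + Q')) ^ m := pow_le_pow_left₀ h0 h1 m
  have h3 : 1 + c * Q ≤ 1 + c' * Q' := by nlinarith [mul_le_mul hcc hQQ hQ (hc.trans hcc)]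
  have h4 : 0 ≤ 1 + c * Q := by nlinarith [mul_nonneg hc hQ]
  exact mul_le_mul h2 h3 h4 (pow_nonneg (h0.trans h1) m)

/-- **Good-component numerics** (pure real arithmetic). Under the type margins, the balanced cut size, the
two windows (`|y₀ − s(2a+b)/N| ≤ Λ`, `|y₀ − h − 2(s−r) − r·b_Y/(b_Y+d_Y)| ≤ L`) and the smallness hypotheses, the
component `Hyp(b_Y, d_Y; r)` (`m = b_Y + d_Y`, mean `μ = r·b_Y/m`, `W = r b_Y d_Y (m−r)/m²`,
`V = r b_Y d_Y (m−r)/(m²(m−1))`) has: the four window margins `≥ 2(L+k+1)`, variance `V ≥ β₁⁴βN`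
(`β₁ = β²/8`), window constant `4(m+2)(L+k+1)/W ≤ 8(L+k+1)/(β₁⁴βN)`, `0 < W`, `r ≤ m ≤ N`, and the reference
point sits at least `k` above the shift: `h + 2(s−r) + k ≤ y₀`.
[cite: RollinRoss2010, §4.1 Thm 4.2] [cite: ChattamvelliShanmugam2020, §7.4 Table 7.1] -/
theorem good_component_numerics {N a b d bY dY s r h y₀ L Λ β k : ℝ} (hβ : 0 < β) (hβ1 : β ≤ 1)
    (hN : a + b + d = N) (ha0 : 0 ≤ a) (hbβ : β * N + 1 ≤ b) (hdβ : β * N + 1 ≤ d)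
    (hbY : b - 1 ≤ bY) (hbY' : bY ≤ b) (hdY : d - 1 ≤ dY) (hdY' : dY ≤ d)
    (hs : β * N ≤ s) (hs' : 8 * s ≤ (4 + β) * N) (hr0 : 0 ≤ r) (hh0 : 0 ≤ h) (hh1 : h ≤ 1) (hk0 : 0 ≤ k)
    (hy : |y₀ - s * (2 * a + b) / N| ≤ Λ)
    (hgood : |y₀ - h - 2 * (s - r) - r * bY / (bY + dY)| ≤ L) (hL0 : 0 ≤ L)
    (hL1 : L + k + Λ ≤ β * s) (hL2 : L + k + Λ + 3 ≤ β * N / 8)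
    (hwin : 2 * (L + k + 1) ≤ (β ^ 2 / 8) ^ 2 * (β * N)) (hN4 : 4 ≤ β * N) :
    2 * ((L + k) + 1) ≤ bY - r * bY / (bY + dY) ∧
    2 * ((L + k) + 1) ≤ r - r * bY / (bY + dY) ∧
    2 * ((L + k) + 1) ≤ r * bY / (bY + dY) ∧
    2 * ((L + k) + 1) ≤ dY - r + r * bY / (bY + dY) ∧
    (β ^ 2 / 8) ^ 4 * (β * N) ≤ r * bY * dY * (bY + dY - r) / ((bY + dY) ^ 2 * (bY + dY - 1)) ∧
    4 * (bY + dY + 2) * ((L + k) + 1) / (r * bY * dY * (bY + dY - r) / (bY + dY) ^ 2) ≤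
      8 * (L + k + 1) / ((β ^ 2 / 8) ^ 4 * (β * N)) ∧
    0 < r * bY * dY * (bY + dY - r) / (bY + dY) ^ 2 ∧
    r ≤ bY + dY ∧ bY + dY ≤ N ∧ h + 2 * (s - r) + k ≤ y₀ := by
  have hβN : 0 < β * N := by linarith
  have hN0 : 0 < N := pos_of_mul_pos_right hβN hβ.le
  have hL1' : L + Λ ≤ β * s := by linarith
  have hL2' : L + Λ + 3 ≤ β * N / 8 := by linarith
  obtain ⟨hrlo, hrhi⟩ :=
    balanced_of_good hβ hN0 hN ha0 hbβ hdβ hbY hdY hs hs' hr0 hh0 hh1 hy hgood hL1' hL2'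
  -- abbreviations (as plain facts, no `set`)
  have hβ₁0 : 0 < β ^ 2 / 8 := by positivity
  have hβ₁β : β ^ 2 / 8 ≤ β := by nlinarith
  have hmN : bY + dY ≤ N := by linarith
  have hmβ : β * N ≤ bY + dY := by linarith
  have hm0 : 0 < bY + dY := by linarith
  have hm4 : 4 ≤ bY + dY := hN4.trans hmβ
  have hβ₁m : β ^ 2 / 8 * (bY + dY) ≤ β ^ 2 / 8 * N := mul_le_mul_of_nonneg_left hmN hβ₁0.le
  have hβ₁N : β ^ 2 / 8 * N ≤ β * N := mul_le_mul_of_nonneg_right hβ₁β hN0.le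
  have hbYm : β ^ 2 / 8 * (bY + dY) ≤ bY := by linarith
  have hdYm : β ^ 2 / 8 * (bY + dY) ≤ dY := by linarith
  have hβ2N : 0 ≤ β ^ 2 * N := by positivity
  have hrm : β ^ 2 / 8 * (bY + dY) ≤ r := by linarith
  have hrm' : r + β ^ 2 / 8 * (bY + dY) ≤ bY + dY := by
    have : β ^ 2 / 8 * N ≤ β * N / 8 := by nlinarith
    linarith
  -- variance
  have hVge : (β ^ 2 / 8) ^ 4 * (bY + dY) ≤ r * bY * dY * (bY + dY - r) / ((bY + dY) ^ 2 * (bY + dY - 1)) :=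
    hypVar_ge hβ₁0 (by linarith) hbYm hdYm hrm hrm'
  have hVb : (β ^ 2 / 8) ^ 4 * (β * N) ≤ r * bY * dY * (bY + dY - r) / ((bY + dY) ^ 2 * (bY + dY - 1)) :=
    le_trans (mul_le_mul_of_nonneg_left hmβ (by positivity)) hVge
  have hV0 : 0 < r * bY * dY * (bY + dY - r) / ((bY + dY) ^ 2 * (bY + dY - 1)) :=
    lt_of_lt_of_le (by positivity) hVb
  have hm1 : bY + dY - 1 ≠ 0 := by linarith
  have hm0' : bY + dY ≠ 0 := hm0.ne'
  have hWV : r * bY * dY * (bY + dY - r) / (bY + dY) ^ 2 =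
      (bY + dY - 1) * (r * bY * dY * (bY + dY - r) / ((bY + dY) ^ 2 * (bY + dY - 1))) := by
    field_simp
  have hW0 : 0 < r * bY * dY * (bY + dY - r) / (bY + dY) ^ 2 := by
    rw [hWV]; exact mul_pos (by linarith) hV0
  -- margins
  have hμeq1 : bY - r * bY / (bY + dY) = bY * ((bY + dY - r) / (bY + dY)) := by field_simp
  have hμeq2 : r - r * bY / (bY + dY) = r * (dY / (bY + dY)) := by field_simp; ring
  have hμeq3 : r * bY / (bY + dY) = r * (bY / (bY + dY)) := by rw [mul_div_assoc]
  have hμeq4 : dY - r + r * bY / (bY + dY) = dY * ((bY + dY - r) / (bY + dY)) := by field_simp; ring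
  have hf1 : β ^ 2 / 8 ≤ (bY + dY - r) / (bY + dY) := by rw [le_div_iff₀ hm0]; linarith
  have hf2 : β ^ 2 / 8 ≤ dY / (bY + dY) := by rw [le_div_iff₀ hm0]; linarith
  have hf3 : β ^ 2 / 8 ≤ bY / (bY + dY) := by rw [le_div_iff₀ hm0]; linarith
  have hsq : 2 * ((L + k) + 1) ≤ β ^ 2 / 8 * (bY + dY) * (β ^ 2 / 8) := by
    have h' : (β ^ 2 / 8) ^ 2 * (β * N) ≤ (β ^ 2 / 8) ^ 2 * (bY + dY) :=
      mul_le_mul_of_nonneg_left hmβ (by positivity)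
    calc 2 * ((L + k) + 1) = 2 * (L + k + 1) := by ring
      _ ≤ (β ^ 2 / 8) ^ 2 * (β * N) := hwin
      _ ≤ (β ^ 2 / 8) ^ 2 * (bY + dY) := h'
      _ = β ^ 2 / 8 * (bY + dY) * (β ^ 2 / 8) := by ring
  have hM1 : 2 * ((L + k) + 1) ≤ bY - r * bY / (bY + dY) := by
    rw [hμeq1]; exact hsq.trans (mul_le_mul hbYm hf1 hβ₁0.le (by linarith))
  have hM2 : 2 * ((L + k) + 1) ≤ r - r * bY / (bY + dY) := by
    rw [hμeq2]; exact hsq.trans (mul_le_mul hrm hf2 hβ₁0.le hr0)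
  have hM3 : 2 * ((L + k) + 1) ≤ r * bY / (bY + dY) := by
    rw [hμeq3]; exact hsq.trans (mul_le_mul hrm hf3 hβ₁0.le hr0)
  have hM4 : 2 * ((L + k) + 1) ≤ dY - r + r * bY / (bY + dY) := by
    rw [hμeq4]; exact hsq.trans (mul_le_mul hdYm hf1 hβ₁0.le (by linarith))
  refine ⟨hM1, hM2, hM3, hM4, hVb, ?_, hW0, by linarith only [hrm', (mul_pos hβ₁0 hm0).le], hmN, ?_⟩
  · -- `4(m+2)(L+k+1)/W ≤ 8(L+k+1)/(β₁⁴βN)`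
    rw [div_le_div_iff₀ hW0 (by positivity)]
    have hLk : 0 ≤ (L + k) + 1 := by linarith only [hL0, hk0]
    have hW1 : (bY + dY - 1) * ((β ^ 2 / 8) ^ 4 * (bY + dY)) ≤ r * bY * dY * (bY + dY - r) / (bY + dY) ^ 2 := by
      rw [hWV]; exact mul_le_mul_of_nonneg_left hVge (by linarith)
    have hkey : (bY + dY + 2) * (β * N) ≤ 2 * ((bY + dY - 1) * (bY + dY)) := by
      have h1 : (bY + dY + 2) * (β * N) ≤ (bY + dY + 2) * (bY + dY) :=
        mul_le_mul_of_nonneg_left hmβ (by linarith)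
      have h2 : (bY + dY + 2) * (bY + dY) ≤ 2 * ((bY + dY - 1) * (bY + dY)) := by
        have h3 : bY + dY + 2 ≤ 2 * (bY + dY - 1) := by linarith
        have := mul_le_mul_of_nonneg_right h3 hm0.le
        linarith
      exact h1.trans h2
    calc 4 * (bY + dY + 2) * ((L + k) + 1) * ((β ^ 2 / 8) ^ 4 * (β * N))
        = 4 * ((L + k) + 1) * (β ^ 2 / 8) ^ 4 * ((bY + dY + 2) * (β * N)) := by ring
      _ ≤ 4 * ((L + k) + 1) * (β ^ 2 / 8) ^ 4 * (2 * ((bY + dY - 1) * (bY + dY))) :=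
          mul_le_mul_of_nonneg_left hkey (by positivity)
      _ = 8 * (L + k + 1) * ((bY + dY - 1) * ((β ^ 2 / 8) ^ 4 * (bY + dY))) := by ring
      _ ≤ 8 * (L + k + 1) * (r * bY * dY * (bY + dY - r) / (bY + dY) ^ 2) :=
          mul_le_mul_of_nonneg_left hW1 (by linarith only [hL0, hk0])
  · -- `h + 2(s−r) + k ≤ y₀`: `y₀ − h − 2(s−r) ≥ μ − L ≥ 2(L+k+1) − L`
    obtain ⟨hg1, _⟩ := abs_le.1 hgood
    linarith only [hg1, hM3, hL0, hk0]

section Components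

variable (hπ : ∀ v, π (π v) = v) (hπ' : ∀ v, π v ≠ v)
include hπ hπ'
set_option maxHeartbeats 400000 in -- buildfix (bf3-g30): 160k/180k FAIL, 200k PASS at accept time; line-neutral budget line
/-- **THE GOOD-COMPONENT BOUND (uniform constant).** `π`-stable `S` of `H`-type `(a,b,d)`, `a+b+d = N`, type
margins `a, b, d ≥ βN + 1` (`0 < β ≤ 1`), `βN ≤ s ≤ (4+β)N/8`; a reference point `y₀` within `Λ` of `s(2a+b)/N`;
an order `k`, an offset `u ≤ 2k`, a window half-width `L ≥ 0` with `L + k + Λ ≤ βs`, `L + k + Λ + 3 ≤ βN/8`,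
`2(L+k+1) ≤ β₁²βN`, `4 ≤ βN` and `k(1+η̄) ≤ β₁⁴βN` (`β₁ = β²/8`, `η̄ = 8(L+k+1)/(β₁⁴βN)`). Then every component
`(Y, α)` whose centre `|Y∩H| + 2α + (s−α)b_Y/(b_Y+d_Y)` is within `L` of `y₀` satisfies
`|coeff_{y₀+u}((1−X)^{2k}·X^{|Y∩H|+2α}H_{b_Y,d_Y,s−α})| ≤ E_k·coeff_{y₀}(X^{|Y∩H|+2α}H_{b_Y,d_Y,s−α})` with
`E_k = ((1+η̄)(η̄+Q̄))^{2k}(1 + (4(√N+1)/3)Q̄)`, `Q̄ = 2√192·√(2(2k+1)(1+η̄)/(β₁⁴βN))`.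
[cite: Durrett2019, §2.7] [cite: RollinRoss2010, §4.1 Thm 4.2] [cite: Rothvoss2017, §2 (PDF p. 6)] -/
theorem good_component_bound {S : Finset (Fin n)} (hS : ∀ v ∈ S, π v ∈ S) (H : Finset (Fin n))
    {a b d N : ℕ} (hb : (reps π (vBH π S H ∪ vBN π S H)).card = b)
    (hd : (reps π (vDD π S H)).card = d) (hN : a + b + d = N)
    {β : ℝ} (hβ : 0 < β) (hβ1 : β ≤ 1)
    (hbβ : β * N + 1 ≤ b) (hdβ : β * N + 1 ≤ d)
    {s : ℕ} (hs : β * N ≤ s) (hs' : 8 * (s : ℝ) ≤ (4 + β) * N)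
    {k u y₀ : ℕ} (hu : u ≤ 2 * k) {L Λ : ℝ} (hL0 : 0 ≤ L)
    (hL1 : L + k + Λ ≤ β * s) (hL2 : L + k + Λ + 3 ≤ β * N / 8)
    (hwin : 2 * (L + k + 1) ≤ (β ^ 2 / 8) ^ 2 * (β * N)) (hN4 : 4 ≤ β * N)
    (hkV : (k : ℝ) * (1 + 8 * (L + k + 1) / ((β ^ 2 / 8) ^ 4 * (β * N))) ≤ (β ^ 2 / 8) ^ 4 * (β * N))
    (hy : |(y₀ : ℝ) - s * (2 * a + b) / N| ≤ Λ)
    {Y : Finset (Fin n)} (hY : Y ∈ halfSets π S 1) {α : ℕ} (hα : α ≤ s)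
    (hgood : |(y₀ : ℝ) - (Y ∩ H).card - 2 * α -
        ((s - α : ℕ) : ℝ) * (reps π (vBH π (strip π S Y) H ∪ vBN π (strip π S Y) H)).card /
          (((reps π (vBH π (strip π S Y) H ∪ vBN π (strip π S Y) H)).card : ℝ) +
            (reps π (vDD π (strip π S Y) H)).card)| ≤ L) :
    |((1 - X) ^ (2 * k) * (X ^ ((Y ∩ H).card + 2 * α) *
        hyperGen (reps π (vBH π (strip π S Y) H ∪ vBN π (strip π S Y) H)).card
          (reps π (vDD π (strip π S Y) H)).card (s - α))).coeff (y₀ + u)| ≤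
      (((1 + 8 * (L + k + 1) / ((β ^ 2 / 8) ^ 4 * (β * N))) *
            (8 * (L + k + 1) / ((β ^ 2 / 8) ^ 4 * (β * N)) +
              2 * Real.sqrt 192 * Real.sqrt (2 * (2 * (k : ℝ) + 1) *
                (1 + 8 * (L + k + 1) / ((β ^ 2 / 8) ^ 4 * (β * N))) / ((β ^ 2 / 8) ^ 4 * (β * N))))) ^ (2 * k) *
          (1 + 4 * (Real.sqrt N + 1) / 3 *
            (2 * Real.sqrt 192 * Real.sqrt (2 * (2 * (k : ℝ) + 1) *
              (1 + 8 * (L + k + 1) / ((β ^ 2 / 8) ^ 4 * (β * N))) / ((β ^ 2 / 8) ^ 4 * (β * N)))))) *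
        (X ^ ((Y ∩ H).card + 2 * α) *
          hyperGen (reps π (vBH π (strip π S Y) H ∪ vBN π (strip π S Y) H)).card
            (reps π (vDD π (strip π S Y) H)).card (s - α)).coeff y₀ := by
  -- the data
  obtain ⟨-, -, h3, h4, h5, h6, -⟩ := strip_one_types hπ hπ' hS H hY
  obtain ⟨v, -, -, hh1⟩ := halfSets_one_data (H := H) hπ' hY
  rw [hb] at h3 h4
  rw [hd] at h5 h6
  generalize hbY : (reps π (vBH π (strip π S Y) H ∪ vBN π (strip π S Y) H)).card = bY at h3 h4 hgood ⊢
  generalize hdY : (reps π (vDD π (strip π S Y) H)).card = dY at h5 h6 hgood ⊢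
  generalize hσ : (Y ∩ H).card = hv at hh1 hgood ⊢
  obtain ⟨ηb, hηb⟩ : ∃ e : ℝ, e = 8 * (L + k + 1) / ((β ^ 2 / 8) ^ 4 * (β * N)) := ⟨_, rfl⟩
  obtain ⟨Vb, hVb⟩ : ∃ e : ℝ, e = (β ^ 2 / 8) ^ 4 * (β * N) := ⟨_, rfl⟩
  obtain ⟨Qb, hQb⟩ : ∃ e : ℝ, e = 2 * Real.sqrt 192 * Real.sqrt (2 * (2 * (k : ℝ) + 1) * (1 + ηb) / Vb) :=
    ⟨_, rfl⟩
  rw [← hηb, ← hVb] at hkV ⊢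
  rw [← hQb]
  -- the numerics of the component `Hyp(bY, dY; r)`, `r = s − α`
  obtain ⟨r, hrdef⟩ : ∃ r : ℕ, r = s - α := ⟨_, rfl⟩
  rw [← hrdef] at hgood ⊢
  have hrr : (r : ℝ) = s - α := by rw [hrdef]; push_cast [Nat.cast_sub hα]; ring
  have hgood' : |(y₀ : ℝ) - hv - 2 * ((s : ℝ) - r) - (r : ℝ) * bY / ((bY : ℝ) + dY)| ≤ L := by
    have e : 2 * ((s : ℝ) - r) = 2 * (α : ℝ) := by rw [hrr]; ring
    rw [e]; exact hgood
  obtain ⟨hbm, hrm, hμm, hdm, hVge, hηle, hW0, hrle, hmN, hyσ⟩ :=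
    good_component_numerics (N := (N : ℝ)) (a := a) (b := b) (d := d) (bY := (bY : ℝ))
      (dY := (dY : ℝ)) (s := s) (r := (r : ℝ)) (h := (hv : ℝ)) (y₀ := y₀) (L := L) (Λ := Λ) (β := β) (k := k)
      hβ hβ1 (by exact_mod_cast hN) (Nat.cast_nonneg _) hbβ hdβ
      (by have : (b : ℝ) ≤ bY + 1 := by exact_mod_cast h3
          linarith)
      (by exact_mod_cast h4)
      (by have : (d : ℝ) ≤ dY + 1 := by exact_mod_cast h5
          linarith)
      (by exact_mod_cast h6) hs hs' (Nat.cast_nonneg _) (Nat.cast_nonneg _)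
      (by exact_mod_cast hh1) (Nat.cast_nonneg _) hy hgood' hL0 hL1 hL2 hwin hN4
  rw [← hVb] at hVge
  rw [← hηb] at hηle
  have hVb0 : 0 < Vb := by rw [hVb]; positivity
  have hV0 : 0 < (r : ℝ) * bY * dY * ((bY : ℝ) + dY - r) / (((bY : ℝ) + dY) ^ 2 * ((bY : ℝ) + dY - 1)) :=
    lt_of_lt_of_le hVb0 hVge
  have hη0 : 0 ≤ 4 * ((bY : ℝ) + dY + 2) * ((L + k) + 1) /
      ((r : ℝ) * bY * dY * ((bY : ℝ) + dY - r) / ((bY : ℝ) + dY) ^ 2) := by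
    have : (0 : ℝ) ≤ k := Nat.cast_nonneg _
    positivity
  -- `k(1+η) ≤ V`
  have hkV' : (k : ℝ) * (1 + 4 * ((bY : ℝ) + dY + 2) * ((L + k) + 1) /
      ((r : ℝ) * bY * dY * ((bY : ℝ) + dY - r) / ((bY : ℝ) + dY) ^ 2)) ≤
      (r : ℝ) * bY * dY * ((bY : ℝ) + dY - r) / (((bY : ℝ) + dY) ^ 2 * ((bY : ℝ) + dY - 1)) := by
    calc _ ≤ (k : ℝ) * (1 + ηb) := mul_le_mul_of_nonneg_left (by linarith) (Nat.cast_nonneg _)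
      _ ≤ Vb := hkV
      _ ≤ _ := hVge
  -- local indices `y = y₀ − σ`, `x₁ = y + u − k`
  have hσle : hv + 2 * α + k ≤ y₀ := by
    have h' : (hv : ℝ) + 2 * ((s : ℝ) - r) + k ≤ y₀ := hyσ
    rw [hrr] at h'
    have : ((hv + 2 * α + k : ℕ) : ℝ) ≤ (y₀ : ℝ) := by push_cast; linarith
    exact_mod_cast this
  obtain ⟨y, hyy⟩ : ∃ y : ℕ, y₀ = hv + 2 * α + y := ⟨y₀ - (hv + 2 * α), by omega⟩
  obtain ⟨x₁, hx₁⟩ : ∃ x₁ : ℕ, x₁ + k = y + u := ⟨y + u - k, by omega⟩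
  have hyr : (y : ℝ) = (y₀ : ℝ) - hv - 2 * α := by
    have : (y₀ : ℝ) = ((hv + 2 * α + y : ℕ) : ℝ) := by rw [← hyy]
    push_cast at this; linarith
  have hx₁r : (x₁ : ℝ) = y + u - k := by
    have : ((x₁ + k : ℕ) : ℝ) = ((y + u : ℕ) : ℝ) := by rw [hx₁]
    push_cast at this; linarith
  obtain ⟨hg1, hg2⟩ := abs_le.1 hgood
  have hk0 : (0 : ℝ) ≤ k := Nat.cast_nonneg _
  have hu0 : (0 : ℝ) ≤ u := Nat.cast_nonneg _
  have hur : (u : ℝ) ≤ 2 * k := by exact_mod_cast hu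
  have hyw : |(y : ℝ) - (r : ℝ) * bY / ((bY : ℝ) + dY)| ≤ L + k := by
    rw [abs_le, hyr]; constructor <;> linarith
  have hx₁w : |(x₁ : ℝ) - (r : ℝ) * bY / ((bY : ℝ) + dY)| ≤ L + k := by
    rw [abs_le, hx₁r, hyr]; constructor <;> linarith
  -- the off-centre good bound for the component, window half-width `L + k`
  have hgoodB := hyperGen_abs_nabla_even_le_of_window (b := bY) (d := dY) (r := r) (k := k) (u := u)
    (y := y) (x₁ := x₁) (L := L + k) rfl rfl rfl hV0 hx₁ hu hyw hx₁w hbm hrm hμm hdm hkV'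
  -- unshift the component
  have hshift : ((1 - X) ^ (2 * k) * (X ^ (hv + 2 * α) * hyperGen bY dY r)).coeff (y₀ + u) =
      ((1 - X) ^ (2 * k) * hyperGen bY dY r).coeff (y + u) := by
    rw [show (1 - X : ℝ[X]) ^ (2 * k) * (X ^ (hv + 2 * α) * hyperGen bY dY r) =
      X ^ (hv + 2 * α) * ((1 - X) ^ (2 * k) * hyperGen bY dY r) by ring,
      coeff_X_pow_mul', if_pos (by omega)]
    congr 1; omega
  have hshift0 : (X ^ (hv + 2 * α) * hyperGen bY dY r).coeff y₀ = (hyperGen bY dY r).coeff y := by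
    rw [coeff_X_pow_mul', if_pos (by omega)]; congr 1; omega
  rw [hshift, hshift0]
  -- monotonicity of the constant: `η ≤ η̄`, `Q ≤ Q̄`, `√r ≤ √N`
  have hQle : 2 * Real.sqrt 192 * Real.sqrt (2 * (2 * (k : ℝ) + 1) *
      (1 + 4 * ((bY : ℝ) + dY + 2) * ((L + k) + 1) /
        ((r : ℝ) * bY * dY * ((bY : ℝ) + dY - r) / ((bY : ℝ) + dY) ^ 2)) /
      ((r : ℝ) * bY * dY * ((bY : ℝ) + dY - r) / (((bY : ℝ) + dY) ^ 2 * ((bY : ℝ) + dY - 1)))) ≤ Qb := by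
    rw [hQb]
    refine mul_le_mul_of_nonneg_left (Real.sqrt_le_sqrt ?_) (by positivity)
    have hnum : 2 * (2 * (k : ℝ) + 1) * (1 + 4 * ((bY : ℝ) + dY + 2) * ((L + k) + 1) /
        ((r : ℝ) * bY * dY * ((bY : ℝ) + dY - r) / ((bY : ℝ) + dY) ^ 2)) ≤
        2 * (2 * (k : ℝ) + 1) * (1 + ηb) := mul_le_mul_of_nonneg_left (by linarith) (by positivity)
    calc _ ≤ 2 * (2 * (k : ℝ) + 1) * (1 + ηb) /
          ((r : ℝ) * bY * dY * ((bY : ℝ) + dY - r) / (((bY : ℝ) + dY) ^ 2 * ((bY : ℝ) + dY - 1))) :=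
          div_le_div_of_nonneg_right hnum hV0.le
      _ ≤ 2 * (2 * (k : ℝ) + 1) * (1 + ηb) / Vb := by
          refine div_le_div_of_nonneg_left ?_ hVb0 hVge
          have : 0 ≤ ηb := by rw [hηb]; positivity
          positivity
  have hsqrt : Real.sqrt r ≤ Real.sqrt N := Real.sqrt_le_sqrt (hrle.trans hmN)
  have hc : 4 * (Real.sqrt r + 1) / 3 ≤ 4 * (Real.sqrt N + 1) / 3 := by linarith
  have hmono := goodConst_mono (2 * k) hη0 hηle (by positivity) hQle (by positivity) hc
  calc _ ≤ _ := hgoodB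
    _ ≤ (hyperGen bY dY r).coeff y * (((1 + ηb) * (ηb + Qb)) ^ (2 * k) * (1 + 4 * (Real.sqrt N + 1) / 3 * Qb)) :=
        mul_le_mul_of_nonneg_left hmono (coeff_hyperGen_nonneg _ _ _ _)
    _ = _ := mul_comm _ _

end Components

/-! ### §4 The far-component bound -/

/-- **THE FAR-COMPONENT BOUND.** For a component `X^{h+2α}·H_{b_Y,d_Y,s−α}` whose centre
`h + 2α + (s−α)b_Y/(b_Y+d_Y)` is farther than `L` from the reference point `y₀`, an offset `u ≤ 2k ≤ L`, and
`N ≥ s` with `L − 2k ≤ 2N`: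
`|coeff_{y₀+u}((1−X)^{2k}·X^{h+2α}H_{b_Y,d_Y,s−α})| ≤ 4^k·e^{−(L−2k)²/(4N)}·C(b_Y+d_Y, s−α)` — every stencil point is
at distance `≥ L − 2k` from the component mean `μ ≤ s ≤ N`, and the parametrised Chernoff tail with `u = (L−2k)/(2N)`
gives `exp(u²μ − u(L−2k)) ≤ exp(−(L−2k)²/(4N))`. [cite: Durrett2019, §2.7] [cite: RollinRoss2010, §3 (Lemma 3.1)] -/
theorem far_component_bound {bY dY s α k u y₀ h : ℕ} (hu : u ≤ 2 * k) {N L : ℝ}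
    (hsN : (s : ℝ) ≤ N) (hN0 : 0 < N) (h2kL : 2 * (k : ℝ) ≤ L) (hLN : L - 2 * k ≤ 2 * N)
    (hfar : L < |(y₀ : ℝ) - h - 2 * α -
        ((s - α : ℕ) : ℝ) * bY / ((bY : ℝ) + dY)|) :
    |((1 - X) ^ (2 * k) * (X ^ (h + 2 * α) * hyperGen bY dY (s - α))).coeff (y₀ + u)| ≤
      (4 : ℝ) ^ k * Real.exp (-((L - 2 * k) ^ 2 / (4 * N))) * (((bY + dY).choose (s - α) : ℕ) : ℝ) := by
  rcases Nat.lt_or_ge (bY + dY) (s - α) with hlt | hr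
  · -- degenerate component: the polynomial vanishes
    rw [hyperGen_eq_zero_of_lt hlt, mul_zero, mul_zero, coeff_zero, abs_zero]
    positivity
  · set μ : ℝ := ((s - α : ℕ) : ℝ) * bY / ((bY : ℝ) + dY) with hμ
    have hμ0 : 0 ≤ μ := by rw [hμ]; positivity
    have hμr : μ ≤ ((s - α : ℕ) : ℝ) := by
      rw [hμ]
      rcases eq_or_lt_of_le (show (0 : ℝ) ≤ (bY : ℝ) + dY by positivity) with h0 | hpos
      · rw [← h0, div_zero]; exact Nat.cast_nonneg _
      · rw [div_le_iff₀ hpos]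
        exact mul_le_mul_of_nonneg_left (by linarith [(Nat.cast_nonneg dY : (0 : ℝ) ≤ dY)]) (Nat.cast_nonneg _)
    have hμN : μ ≤ N := hμr.trans ((by exact_mod_cast Nat.sub_le s α : ((s - α : ℕ) : ℝ) ≤ s).trans hsN)
    set u₀ : ℝ := (L - 2 * k) / (2 * N) with hu₀
    have hu₀0 : 0 ≤ u₀ := by rw [hu₀]; exact div_nonneg (by linarith) (by linarith)
    have hu₀1 : u₀ ≤ 1 := by rw [hu₀, div_le_one (by linarith)]; linarith
    have hfar' : ∀ l, l ≤ 2 * k → h + 2 * α + l ≤ y₀ + u →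
        L - 2 * k ≤ |(((y₀ + u - (h + 2 * α) - l : ℕ) : ℝ)) - μ| := by
      intro l hl hle
      have hcast : (((y₀ + u - (h + 2 * α) - l : ℕ) : ℝ)) = (y₀ : ℝ) + u - h - 2 * α - l := by
        have e : y₀ + u - (h + 2 * α) - l + l + (h + 2 * α) = y₀ + u := by omega
        have := congrArg (fun n : ℕ => (n : ℝ)) e
        push_cast at this
        linarith
      rw [hcast]
      have hul : |(u : ℝ) - l| ≤ 2 * k := by
        have h1 : (u : ℝ) ≤ 2 * k := by exact_mod_cast hu
        have h2 : (l : ℝ) ≤ 2 * k := by exact_mod_cast hl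
        rw [abs_le]; constructor <;> linarith [(Nat.cast_nonneg u : (0:ℝ) ≤ u), (Nat.cast_nonneg l : (0:ℝ) ≤ l)]
      -- `|A + (u − l)| ≥ |A| − |u − l|`
      have htri := abs_sub_abs_le_abs_sub ((y₀ : ℝ) - h - 2 * α - μ) ((l : ℝ) - u)
      have e2 : (y₀ : ℝ) - h - 2 * α - μ - ((l : ℝ) - u) = (y₀ : ℝ) + u - h - 2 * α - l - μ := by ring
      rw [e2] at htri
      rw [abs_sub_comm (l : ℝ)] at htri
      linarith
    have hmain := hyperGen_abs_nabla_shift_le_of_far hr (h + 2 * α) (y₀ + u) (2 * k) hμ hu₀0 hu₀1 hfar'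
    refine hmain.trans ?_
    rw [pow_mul, show (2 : ℝ) ^ 2 = 4 by norm_num]
    rw [mul_comm (((( bY + dY).choose (s - α) : ℕ) : ℝ)) _, ← mul_assoc]
    refine mul_le_mul_of_nonneg_right (mul_le_mul_of_nonneg_left (Real.exp_le_exp.2 ?_) (by positivity))
      (Nat.cast_nonneg _)
    -- `u₀²μ − u₀(L−2k) ≤ −(L−2k)²/(4N)`
    have hN2 : 0 < 2 * N := by linarith
    have e1 : u₀ * (L - 2 * k) = (L - 2 * k) ^ 2 / (2 * N) := by rw [hu₀]; field_simp
    have e2 : u₀ ^ 2 * N = (L - 2 * k) ^ 2 / (4 * N) := by rw [hu₀]; field_simp; ring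
    have h1 : u₀ ^ 2 * μ ≤ u₀ ^ 2 * N := mul_le_mul_of_nonneg_left hμN (sq_nonneg _)
    have h2 : (L - 2 * k) ^ 2 / (2 * N) = 2 * ((L - 2 * k) ^ 2 / (4 * N)) := by field_simp; ring
    nlinarith [h1, e1, e2, h2, sq_nonneg (L - 2 * k), div_nonneg (sq_nonneg (L - 2 * k)) (by linarith : (0:ℝ) ≤ 4 * N)]

/-! ### §5 The pointwise relative bound for one ground set -/

section OneGroundSet

variable (hπ : ∀ v, π (π v) = v) (hπ' : ∀ v, π v ≠ v)
include hπ hπ'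

/-- **POINTWISE RELATIVE `x`-SMOOTHNESS OF A LEVEL-`1` SHELL LAW.** `π` a fixed-point-free involution, `S` `π`-stable
of `H`-type `(a,b,d)` with `a + b + d = N`, type margins `b, d ≥ βN + 1` (`0 < β ≤ 1`), `βN ≤ s ≤ (4+β)N/8`
(`s ≤ N`); a reference point `y₀` within `Λ` of `s(2a+b)/N`, an order `k`, an offset `u ≤ 2k`, a window half-width
`L` with `2k ≤ L`, `L − 2k ≤ 2N`, `L + k + Λ ≤ βs`, `L + k + Λ + 3 ≤ βN/8`, `2(L+k+1) ≤ β₁²βN`, `4 ≤ βN`,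
`k(1+η̄) ≤ β₁⁴βN`. Then
`|(∇²)^k law_S(2s+1,·)(1)(y₀+u)| ≤ E_k·law_S(2s+1,1;y₀) + 4^k·e^{−(L−2k)²/(4N)}`,
`E_k = ((1+η̄)(η̄+Q̄))^{2k}(1 + (4(√N+1)/3)Q̄)` as in `good_component_bound`.
[cite: RollinRoss2010, §3 (Lemma 3.3), §4.1 Thm 4.2] [cite: Rothvoss2017, §2 (PDF p. 6)] [cite: Durrett2019, §2.7] -/
theorem abs_nab2_iter_shellLaw_one_le {S : Finset (Fin n)} (hS : ∀ v ∈ S, π v ∈ S) (H : Finset (Fin n))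
    {a b d N : ℕ} (hb : (reps π (vBH π S H ∪ vBN π S H)).card = b)
    (hd : (reps π (vDD π S H)).card = d) (hN : a + b + d = N)
    {β : ℝ} (hβ : 0 < β) (hβ1 : β ≤ 1)
    (hbβ : β * N + 1 ≤ b) (hdβ : β * N + 1 ≤ d)
    {s : ℕ} (hs : β * N ≤ s) (hs' : 8 * (s : ℝ) ≤ (4 + β) * N) (hsN : s ≤ N)
    {k u y₀ : ℕ} (hu : u ≤ 2 * k) {L Λ : ℝ} (h2kL : 2 * (k : ℝ) ≤ L) (hLN : L - 2 * k ≤ 2 * N)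
    (hL1 : L + k + Λ ≤ β * s) (hL2 : L + k + Λ + 3 ≤ β * N / 8)
    (hwin : 2 * (L + k + 1) ≤ (β ^ 2 / 8) ^ 2 * (β * N)) (hN4 : 4 ≤ β * N)
    (hkV : (k : ℝ) * (1 + 8 * (L + k + 1) / ((β ^ 2 / 8) ^ 4 * (β * N))) ≤ (β ^ 2 / 8) ^ 4 * (β * N))
    (hy : |(y₀ : ℝ) - s * (2 * a + b) / N| ≤ Λ) :
    |nab2^[k] (fun c' x => shellLaw π S H (1 + 2 * s) c' x : Profile) 1 ((y₀ + u : ℕ) : ℤ)| ≤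
      (((1 + 8 * (L + k + 1) / ((β ^ 2 / 8) ^ 4 * (β * N))) *
            (8 * (L + k + 1) / ((β ^ 2 / 8) ^ 4 * (β * N)) +
              2 * Real.sqrt 192 * Real.sqrt (2 * (2 * (k : ℝ) + 1) *
                (1 + 8 * (L + k + 1) / ((β ^ 2 / 8) ^ 4 * (β * N))) / ((β ^ 2 / 8) ^ 4 * (β * N))))) ^ (2 * k) *
          (1 + 4 * (Real.sqrt N + 1) / 3 *
            (2 * Real.sqrt 192 * Real.sqrt (2 * (2 * (k : ℝ) + 1) *
              (1 + 8 * (L + k + 1) / ((β ^ 2 / 8) ^ 4 * (β * N))) / ((β ^ 2 / 8) ^ 4 * (β * N)))))) *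
        shellLaw π S H (1 + 2 * s) 1 y₀ +
      (4 : ℝ) ^ k * Real.exp (-((L - 2 * k) ^ 2 / (4 * N))) := by
  classical
  have hL0 : 0 ≤ L := le_trans (by positivity) h2kL
  have hN0 : (0 : ℝ) < N := by
    have : (0 : ℝ) < β * N := by linarith
    exact pos_of_mul_pos_right this hβ.le
  -- the good set: components whose centre is within `L` of `y₀`
  set good : Finset (Finset (Fin n) × ℕ) := (halfSets π S 1 ×ˢ range (s + 1)).filter (fun κ =>
    |(y₀ : ℝ) - (κ.1 ∩ H).card - 2 * κ.2 -
        ((s - κ.2 : ℕ) : ℝ) * (reps π (vBH π (strip π S κ.1) H ∪ vBN π (strip π S κ.1) H)).card /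
          (((reps π (vBH π (strip π S κ.1) H ∪ vBN π (strip π S κ.1) H)).card : ℝ) +
            (reps π (vDD π (strip π S κ.1) H)).card)| ≤ L) with hgood
  have hcast : ((y₀ + u : ℕ) : ℤ) = ((y₀ + u : ℕ) : ℤ) := rfl
  refine abs_nab2_iter_shellLaw_le_of_good_far hπ hπ' hS H 1 s k (y₀ + u) y₀ (by positivity) (by positivity) good
    ?_ ?_
  · intro Y hY α hα hmem
    have hαs : α ≤ s := Nat.lt_succ_iff.1 (mem_range.1 hα)
    have hg := (mem_filter.1 hmem).2
    exact good_component_bound hπ hπ' hS H hb hd hN hβ hβ1 hbβ hdβ hs hs' hu hL0 hL1 hL2 hwin hN4 hkV hy hY hαs hg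
  · intro Y hY α hα hnot
    have hfar : L < |(y₀ : ℝ) - (Y ∩ H).card - 2 * α -
        ((s - α : ℕ) : ℝ) * (reps π (vBH π (strip π S Y) H ∪ vBN π (strip π S Y) H)).card /
          (((reps π (vBH π (strip π S Y) H ∪ vBN π (strip π S Y) H)).card : ℝ) +
            (reps π (vDD π (strip π S Y) H)).card)| := by
      by_contra hle
      exact hnot (mem_filter.2 ⟨mem_product.2 ⟨hY, hα⟩, not_lt.1 hle⟩)
    exact far_component_bound hu (by exact_mod_cast hsN) hN0 h2kL hLN hfar

end OneGroundSet

end ShellStep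

end Literature.Combinatorics.Optimization

end
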